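import Literature.NumberTheory.GaloisRepresentations.ContinuousRep
import Mathlib.Data.ZMod.Basic
import Mathlib.GroupTheory.OrderOfElement
import HarnessLib

/-!
# Route `ByReductionTypeAtTwo`, item `OrdKatoHalfAtTwo` (stmt-BirchSwinnertonDyer-19271), TOWER road, the
# GOOD-ORDINARY local tower kernels at `v ∣ 2` at FULL `2`-power depth: BRICK D, part 2 — counting equivariant
# homomorphisms of a cyclic module into `μ` by the Frobenius-fixed multiples of its generator (pure algebra)

HONEST FRAMING (cell `bsd-2adic`, run/shared/lean/pub/bsd-2adic/, seat `bsd-2adic-tower-1` GEN 20, HUMAN RULINGS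
D-0036 / D-0054 / D-0074): TOOL theorem only (pure algebra; no definition, no named fact, no `sorry`); closes nothing
by itself; nothing booked; BSD is not proved by any of this. Companion of BRICK D (`…GoodOrdTowerControlDualBound.lean`:
`#H²(H, M) ≤ #Hom_H(M, μ_{p^k})`) in the programme «UNIFORM layer bound at a good ordinary `2`» ⇒
`WeierstrassCurve.Greenberg1999_kerG_bounded` / Mazur's control theorem `WeierstrassCurve.selmer_control` over `ℚ` at `p = 2`.
For `M = Ê[2^k] = ℤ P` and the Frobenius `τ ∈ H_∞ ⊆ H_n` fixing `μ_{2^∞}` (so acting trivially on `μ_{2^k}`) and acting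
on `P` by a scalar `b` (`= χ(τ) φ(τ)⁻¹ = φ(τ)⁻¹`, the inverse unit root), an `H_n`-equivariant `f : M → μ` is determined by
`f(P)`, which satisfies `b · f(P) = f(τ P) = τ f(P) = f(P)`; so `#Hom_H(M, μ) ≤ #{z ∈ μ : b z = z} = #{i < 2^k : τ(iP) = iP}`,
the count bounded by `#Ẽ(𝔽₂)` in the tree's layer-`0` file (`WeierstrassCurve.card_filter_smul_nsmul_eq_le`).

* `natCard_equivariant_le_card_filter` — the inequality above, for any group `Γ`, subgroup `H ∋ τ`, representations
  `ρ` on `M = ℤ P` (`P` of order `q`) and `ω` on `Ω ≃+ ZMod q` with `ω τ = 1`, `ρ τ P = b P`.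

References: J. Milne, *Arithmetic Duality Theorems* (2006), I §0 (`M^D = Hom(M, μ)`); R. Greenberg, LNM 1716 (1999), §2
p. 70 (`φψ = χ` on the ordinary filtration), §3 Lemma 3.4 (p. 89).
-/

set_option autoImplicit false
-- the Theorems namespace of this sub repeats the summit name by design (D-0017 nested layout: Summit.<S>.<Sub>)
set_option linter.dupNamespace false

noncomputable section

open scoped Classical

namespace Summit.BirchSwinnertonDyer.BirchSwinnertonDyer.Theorems.GoodOrdTower

open Literature.NumberTheory.GaloisRepresentations

/-- **Equivariant homomorphisms of a cyclic module versus fixed multiples of its generator.** Let `Γ` act on `M` and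
`Ω` through representations `ρ`, `ω`; let `P ∈ M` of additive order `q > 0` generate `M`, let `e : Ω ≃+ ZMod q`, and let
`τ ∈ H ≤ Γ` act trivially on `Ω` and by `ρ τ P = b P` on `P`. Then the `H`-equivariant additive maps `M → Ω` number at
most `#{i < q : ρ τ (iP) = iP}`: such an `f` is determined by `z = f(P)`, and `b z = f(τP) = τ z = z`; both
`{z : b z = z}` and `{i : ρ τ (iP) = iP}` are `{x ∈ ℤ/q : (b − 1) x = 0}`. [cite: MilneADT2006, I §0] -/
theorem natCard_equivariant_le_card_filter {Γ : Type*} [Group Γ] [TopologicalSpace Γ] (H : Subgroup Γ)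
    {M : Type*} [AddCommGroup M] [Module ℤ M] [TopologicalSpace M] (ρ : ContinuousRep Γ ℤ M)
    {Ω : Type*} [AddCommGroup Ω] [Module ℤ Ω] [TopologicalSpace Ω] (ω : ContinuousRep Γ ℤ Ω)
    {q : ℕ} [NeZero q] (e : Ω ≃+ ZMod q)
    {P : M} (hP : addOrderOf P = q) (hgen : ∀ m : M, ∃ i : ℕ, m = i • P)
    {τ : Γ} (hτ : τ ∈ H) (hτω : ∀ z : Ω, ω τ z = z) {b : ℕ} (hb : ρ τ P = b • P) :
    Nat.card {f : M →+ Ω // ∀ (h : H) (m : M), f (ρ (h : Γ) m) = ω (h : Γ) (f m)} ≤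
      ((Finset.range q).filter fun i : ℕ ↦ ρ τ (i • P) = i • P).card := by
  -- `i • P = j • P ↔ i = j in ℤ/q`
  have hnsmul : ∀ i j : ℕ, i • P = j • P ↔ (i : ZMod q) = (j : ZMod q) := fun i j ↦ by
    rw [nsmul_eq_nsmul_iff_modEq, hP, ZMod.natCast_eq_natCast_iff]
  -- the target finite set `T = {x ∈ ℤ/q : b x = x}`
  let T : Finset (ZMod q) := Finset.univ.filter fun x : ZMod q ↦ (b : ZMod q) * x = x
  -- `f ↦ e (f P)` is injective on equivariant maps and lands in `T`
  let Φ : {f : M →+ Ω // ∀ (h : H) (m : M), f (ρ (h : Γ) m) = ω (h : Γ) (f m)} → T := fun f ↦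
    ⟨e (f.1 P), by
      rw [Finset.mem_filter]
      refine ⟨Finset.mem_univ _, ?_⟩
      have h1 : f.1 (ρ τ P) = f.1 P := by rw [f.2 ⟨τ, hτ⟩ P, hτω]
      rw [hb, map_nsmul] at h1
      have h2 := congrArg e h1
      rw [map_nsmul, nsmul_eq_mul] at h2
      exact h2⟩
  have hΦ : Function.Injective Φ := by
    intro f f' hff'
    have h1 : f.1 P = f'.1 P := e.injective (congrArg Subtype.val hff')
    refine Subtype.ext (AddMonoidHom.ext fun m ↦ ?_)
    obtain ⟨i, rfl⟩ := hgen m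
    rw [map_nsmul, map_nsmul, h1]
  have hcard : Nat.card {f : M →+ Ω // ∀ (h : H) (m : M), f (ρ (h : Γ) m) = ω (h : Γ) (f m)} ≤ T.card := by
    have h := Nat.card_le_card_of_injective Φ hΦ
    rwa [Nat.card_eq_fintype_card (α := ↥T), Fintype.card_coe] at h
  refine hcard.trans (le_of_eq ?_)
  -- `T` and `{i < q : ρ τ (iP) = iP}` correspond under `i ↦ (i : ℤ/q)`
  refine (Finset.card_bij' (fun (i : ℕ) _ ↦ (i : ZMod q)) (fun (x : ZMod q) _ ↦ x.val) ?_ ?_ ?_ ?_).symm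
  · intro i hi
    rw [Finset.mem_filter] at hi ⊢
    refine ⟨Finset.mem_univ _, ?_⟩
    have h := hi.2
    rw [map_nsmul, hb, ← mul_nsmul', hnsmul, Nat.cast_mul] at h
    rw [mul_comm]; exact h
  · intro x hx
    rw [Finset.mem_filter] at hx ⊢
    refine ⟨Finset.mem_range.mpr (ZMod.val_lt x), ?_⟩
    rw [map_nsmul, hb, ← mul_nsmul', hnsmul, Nat.cast_mul, ZMod.natCast_zmod_val, mul_comm]
    exact hx.2
  · intro i hi
    rw [Finset.mem_filter, Finset.mem_range] at hi
    exact ZMod.val_cast_of_lt hi.1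
  · intro x _
    exact ZMod.natCast_zmod_val x

end Summit.BirchSwinnertonDyer.BirchSwinnertonDyer.Theorems.GoodOrdTower

end
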